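import Summits.BirchSwinnertonDyer.BirchSwinnertonDyer.Theorems.PrintCFramBottomClassIndexLawFiveLeSelmerDevissageLocalCriterion
import Summits.BirchSwinnertonDyer.BirchSwinnertonDyer.Theorems.PrintCFramBottomClassIndexLawFiveLeLevelDictionaryPadic
import HarnessLib

/-!
# Route `PrintCFram`, crux C2 `BottomClassIndexLawFiveLe` (stmt-BirchSwinnertonDyer-20372), line
# `eisenstein-resource-bdp-line` (registry v19, stub B1 `stub_bsdp_of_classFactor`): **THE LOCAL KUMMER CRITERION, II —
# THE LINK WITH THE CRUX'S LEVEL BINDER**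
# (cell `bsd-print-cfram`, width seat `bsd-line-cfram-p1-w6` g4; helper `--supports` 20372; 0 defs, 0 facts, 0 sorry)

HONEST FRAMING. Nothing about BSD is proved here and no stub is closed. Sequel of `…SelmerDevissageLocalCriterion`
(notation there: `v ∣ p`, `j : W(ℚ_v) → W(K̄_v)`, `ι = pointsMap`, `Φ ≤ W[p]` stable; a `Φ`-ADAPTED `p`-th root of a
rational local point is a root whose Kummer cocycle on `Γ_v` is `Φ`-valued; (LA) «every rational local point has one»,
(LT) «every rational local point having one is `p`-divisible in `W(ℚ_v)`»). The crux's own binder for a rational point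
`P ∈ W(ℚ)` is the LEVEL condition `∃ Q : W(ℚ_[p]), p • Q = W.toPadicPoint p P` (Mathlib's `ℚ_[p]`; LEAD g10 report
§2(d)); w4 g8's `LevelDictionaryPadic` moved it to the completion `ℚ_v`, here the converse transport is added and the
two local conditions are read on rational points:

* `exists_toPadicPoint_eq_of_baseChange_eq_nsmul` — `p`-divisibility in `W(ℚ_v)` ⟹ the level binder at `ℚ_[p]`
  (transport along Mathlib's `padicEquiv v`; converse of w4 g8's `exists_baseChange_eq_zsmul_of_toPadicPoint`).
* **`exists_toPadicPoint_eq_of_forall_imp_of_adaptedRoot`** — under (LT), a rational point with a `Φ`-adapted `p`-th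
  root at `v` has LEVEL ≥ 1 (hence, for the generator of a CM-ramified class member, B1's premise `‖B_{1,ψ⁻¹}‖ ≤ p⁻¹`
  by w6 g3's (α) `LevelDictionaryAlpha.norm_bernoulliOnePrim_le_of_level_pos_of_generator` — not re-imported here).
* **`exists_adaptedRoot_of_forall_exists_adaptedRoot`** — under (LA) every rational point has a `Φ`-adapted root at `v`.
* **`not_exists_adaptedRoot_of_forall_imp_of_level_zero`** — contrapositive reading on a (LT)-member: a rational
  point of LEVEL `0` (`∀ Q, p • Q ≠ toPadicPoint p P`, the Kriz–Li locus' shape by w6 g3's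
  `level_eq_zero_of_unit_classFactor`) has NO `Φ`-adapted root at `v` — on a transverse member the generator is
  visibly off the line `φ̂W'(ℚ_p)`.

THEOREMS ONLY; no definition, no named fact, no `sorry`. BSD is not proved by any of this; no summit statement is
proved by this seat. References: [SilvermanAEC2009] VIII.§2, X.§4 (diagram (**), Rem. 4.7); Mathlib
`Mathlib.NumberTheory.Padics.HeightOneSpectrum`; the LEAD g10 report §2(a)–(d); seat notes w2g9 §3.
-/

set_option autoImplicit false
-- `…BirchSwinnertonDyer.BirchSwinnertonDyer.Theorems…` is the problem's mandated namespace (D-0017).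
set_option linter.dupNamespace false

noncomputable section

open scoped Classical

namespace Summit.BirchSwinnertonDyer.BirchSwinnertonDyer.Theorems.PrintCFram.SelmerCount

open NumberField IsDedekindDomain Field WeierstrassCurve
open Literature.NumberTheory.EllipticCurves Literature.NumberTheory.GaloisRepresentations
  Literature.NumberTheory.EllipticCurves.GreenbergSelmer
open Summit.BirchSwinnertonDyer.BirchSwinnertonDyer.Theorems.PrintCFram.LevelDictionary
open Summit.BirchSwinnertonDyer.Rank1Residual.X2.ResidualDevissageModules

variable (W : WeierstrassCurve ℚ) [W.IsElliptic]

/-! ## §1 From `ℚ_v` to `ℚ_[p]`, and the two local conditions on rational points -/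

section Level

variable {p : ℕ} [hp : Fact p.Prime] (v : HeightOneSpectrum (𝓞 ℚ))
  (Φ : StableSubgroup (absoluteGaloisGroup ℚ) (geomTorsion W (p : ℤ)))

omit [W.IsElliptic] in
/-- The two roads from `W(K)` to `W(K̄_E)` agree: `j (P ⊗ E) = ι (P ⊗ K̄)` (`Affine.Point.map_baseChange` twice; the
`hjP` step of w4 g8's `kummerClassTorsion_mem_torsionLocalKer_of_baseChange_eq_zsmul`, recorded once for reuse). [folklore] -/
theorem map_toAlgHom_baseChange_eq_pointsMap {K : Type} [Field K] (V : WeierstrassCurve K) (E : Type) [Field E]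
    [Algebra K E] (P : V.toAffine.Point) :
    (Affine.Point.map (W' := V) (IsScalarTower.toAlgHom K E (AlgebraicClosure E))
      (Affine.Point.baseChange (W' := V) K E P) : localPoints V E) = pointsMap V E (toGeomPoints V P) := by
  change Affine.Point.map _ (Affine.Point.baseChange (W' := V) K E P) =
    Affine.Point.map (closureEmb (K := K) E) (Affine.Point.baseChange (W' := V) K (AlgebraicClosure K) P)
  rw [Affine.Point.map_baseChange, Affine.Point.map_baseChange]

omit [W.IsElliptic] in
/-- **`p`-divisibility at `ℚ_v` is `p`-divisibility at `ℚ_[p]`** (the crux's currency): if `baseChange P = p • S` in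
`W(ℚ_v)` for the place `v ∋ p`, then `p • Q = toPadicPoint p P` for `Q` the transport of `S` along Mathlib's
`padicEquiv v : ℚ_v ≃ₐ[ℚ] ℚ_[p]` (converse direction of w4 g8's `exists_baseChange_eq_zsmul_of_toPadicPoint`).
[folklore] -/
theorem exists_toPadicPoint_eq_of_baseChange_eq_nsmul (hpv : ((p : ℕ) : 𝓞 ℚ) ∈ v.asIdeal) (P : W.toAffine.Point)
    {S : (W.baseChange (v.adicCompletion ℚ)).toAffine.Point}
    (hS : p • S = Affine.Point.baseChange (W' := W) ℚ (v.adicCompletion ℚ) P) :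
    ∃ Q : (W.baseChange ℚ_[p]).toAffine.Point, p • Q = W.toPadicPoint p P := by
  have hv : (Rat.HeightOneSpectrum.primesEquiv v : ℕ) = p := primesEquiv_eq_of_natCast_mem v hp.out hpv
  subst hv
  let e : v.adicCompletion ℚ ≃ₐ[ℚ] ℚ_[(Rat.HeightOneSpectrum.primesEquiv v : ℕ)] :=
    (Rat.HeightOneSpectrum.adicCompletion.padicEquiv v).toAlgEquiv
  refine ⟨Affine.Point.map (W' := W) (e : v.adicCompletion ℚ →ₐ[ℚ] ℚ_[(Rat.HeightOneSpectrum.primesEquiv v : ℕ)]) S,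
    ?_⟩
  rw [← map_nsmul, hS]
  exact Affine.Point.map_baseChange (W' := W) (F := ℚ)
    (e : v.adicCompletion ℚ →ₐ[ℚ] ℚ_[(Rat.HeightOneSpectrum.primesEquiv v : ℕ)]) P

omit [W.IsElliptic] in
/-- **(LT) ∧ «the rational point has a `Φ`-adapted root at `v`» ⟹ LEVEL ≥ 1.** On a member satisfying (LT) at the
place `v ∋ p` along `Φ`, a rational point `P ∈ W(ℚ)` whose image in `W(ℚ_v)` has a `Φ`-adapted `p`-th root
(= `P ∈ φ̂W'(ℚ_p)` for the isogeny with kernel `Φ`) is `p`-divisible in `W(ℚ_[p])`: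
`∃ Q : W(ℚ_[p]), p • Q = toPadicPoint p P` — the crux's level binder `n ≥ 1`, hence (w6 g3 (α)
`LevelDictionaryAlpha.norm_bernoulliOnePrim_le_of_level_pos_of_generator`, for the generator of a CM-ramified class
member) B1's premise `‖B_{1,ψ⁻¹}‖ ≤ p⁻¹`. [cite: SilvermanAEC2009, X.§4 (diagram (**), Rem. 4.7)] -/
theorem exists_toPadicPoint_eq_of_forall_imp_of_adaptedRoot (hpv : ((p : ℕ) : 𝓞 ℚ) ∈ v.asIdeal)
    (hLT : ∀ P : (W.baseChange (v.adicCompletion ℚ)).toAffine.Point,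
      (∃ R : localPoints W (v.adicCompletion ℚ),
        (p : ℤ) • R = Affine.Point.map (W' := W)
          (IsScalarTower.toAlgHom ℚ (v.adicCompletion ℚ) (AlgebraicClosure (v.adicCompletion ℚ))) P ∧
        ∀ σ : absoluteGaloisGroup (v.adicCompletion ℚ), ∃ t ∈ Φ.toAddSubgroup,
          σ • R - R = pointsMap W (v.adicCompletion ℚ) (t : geomPoints W)) →
      ∃ S : (W.baseChange (v.adicCompletion ℚ)).toAffine.Point, p • S = P)
    (P : W.toAffine.Point)
    (hP : ∃ R : localPoints W (v.adicCompletion ℚ),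
        (p : ℤ) • R = pointsMap W (v.adicCompletion ℚ) (toGeomPoints W P) ∧
        ∀ σ : absoluteGaloisGroup (v.adicCompletion ℚ), ∃ t ∈ Φ.toAddSubgroup,
          σ • R - R = pointsMap W (v.adicCompletion ℚ) (t : geomPoints W)) :
    ∃ Q : (W.baseChange ℚ_[p]).toAffine.Point, p • Q = W.toPadicPoint p P := by
  have hjP := map_toAlgHom_baseChange_eq_pointsMap W (v.adicCompletion ℚ) P
  obtain ⟨R, hR, hRΦ⟩ := hP
  obtain ⟨S, hS⟩ := hLT (Affine.Point.baseChange (W' := W) ℚ (v.adicCompletion ℚ) P) ⟨R, hR.trans hjP.symm, hRΦ⟩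
  exact exists_toPadicPoint_eq_of_baseChange_eq_nsmul W v hpv P hS

omit [W.IsElliptic] hp in
/-- **(LA) ⟹ every rational point has a `Φ`-adapted root at `v`** (the image of `P ∈ W(ℚ)` in `W(ℚ_v)` is a rational
local point). [folklore] -/
theorem exists_adaptedRoot_of_forall_exists_adaptedRoot
    (hLA : ∀ P : (W.baseChange (v.adicCompletion ℚ)).toAffine.Point,
      ∃ R : localPoints W (v.adicCompletion ℚ),
        (p : ℤ) • R = Affine.Point.map (W' := W)
          (IsScalarTower.toAlgHom ℚ (v.adicCompletion ℚ) (AlgebraicClosure (v.adicCompletion ℚ))) P ∧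
        ∀ σ : absoluteGaloisGroup (v.adicCompletion ℚ), ∃ t ∈ Φ.toAddSubgroup,
          σ • R - R = pointsMap W (v.adicCompletion ℚ) (t : geomPoints W))
    (P : W.toAffine.Point) :
    ∃ R : localPoints W (v.adicCompletion ℚ),
        (p : ℤ) • R = pointsMap W (v.adicCompletion ℚ) (toGeomPoints W P) ∧
        ∀ σ : absoluteGaloisGroup (v.adicCompletion ℚ), ∃ t ∈ Φ.toAddSubgroup,
          σ • R - R = pointsMap W (v.adicCompletion ℚ) (t : geomPoints W) := by
  have hjP := map_toAlgHom_baseChange_eq_pointsMap W (v.adicCompletion ℚ) P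
  obtain ⟨R, hR, hRΦ⟩ := hLA (Affine.Point.baseChange (W' := W) ℚ (v.adicCompletion ℚ) P)
  exact ⟨R, hR.trans hjP, hRΦ⟩

omit [W.IsElliptic] in
/-- **On a (LT)-member, a rational point of LEVEL `0` has no `Φ`-adapted root at `v`** (contrapositive of
`exists_toPadicPoint_eq_of_forall_imp_of_adaptedRoot`; LEVEL `0` is the shape `∀ Q, p • Q ≠ toPadicPoint p P` of w6 g3's
`LevelDictionaryAlpha.level_eq_zero_of_unit_classFactor` on the Kriz–Li locus). [cite: SilvermanAEC2009, X.§4 (diagram (**), Rem. 4.7)] -/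
theorem not_exists_adaptedRoot_of_forall_imp_of_level_zero (hpv : ((p : ℕ) : 𝓞 ℚ) ∈ v.asIdeal)
    (hLT : ∀ P : (W.baseChange (v.adicCompletion ℚ)).toAffine.Point,
      (∃ R : localPoints W (v.adicCompletion ℚ),
        (p : ℤ) • R = Affine.Point.map (W' := W)
          (IsScalarTower.toAlgHom ℚ (v.adicCompletion ℚ) (AlgebraicClosure (v.adicCompletion ℚ))) P ∧
        ∀ σ : absoluteGaloisGroup (v.adicCompletion ℚ), ∃ t ∈ Φ.toAddSubgroup,
          σ • R - R = pointsMap W (v.adicCompletion ℚ) (t : geomPoints W)) →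
      ∃ S : (W.baseChange (v.adicCompletion ℚ)).toAffine.Point, p • S = P)
    (P : W.toAffine.Point) (hlev : ∀ Q : (W.baseChange ℚ_[p]).toAffine.Point, p • Q ≠ W.toPadicPoint p P) :
    ¬ ∃ R : localPoints W (v.adicCompletion ℚ),
        (p : ℤ) • R = pointsMap W (v.adicCompletion ℚ) (toGeomPoints W P) ∧
        ∀ σ : absoluteGaloisGroup (v.adicCompletion ℚ), ∃ t ∈ Φ.toAddSubgroup,
          σ • R - R = pointsMap W (v.adicCompletion ℚ) (t : geomPoints W) := by
  intro hP
  obtain ⟨Q, hQ⟩ := exists_toPadicPoint_eq_of_forall_imp_of_adaptedRoot W v Φ hpv hLT P hP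
  exact hlev Q hQ

end Level

end Summit.BirchSwinnertonDyer.BirchSwinnertonDyer.Theorems.PrintCFram.SelmerCount

end
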